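import Literature.Probability.Process.BrownianVecHarmonic
import Literature.Probability.Process.HittingFrom
import HarnessLib

/-!
# Dynkin's martingale between two stopping times: `E[M^f_{t∧σ} − M^f_{t∧τ}; A] = 0` for `A ∈ 𝓕_τ`

Topic `Probability/Process`. For a `d`-dimensional Brownian motion `W` (`IsBrownianVec`,
`BrownianVec`) the tree has optional stopping of Dynkin's martingale
`M^f_t = f(x₀ + W_t) − f(x₀) − ½∫₀ᵗ Δf(x₀ + W_r) dr` at ONE stopping time
(`IsBrownianVec.integral_stoppedProcess_dynkin`: `E[M^f_{t ∧ τ}] = 0`). This file adds the form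
"between two stopping times `τ ≤ σ` on an event `A ∈ 𝓕_τ`", which is what exit estimates STARTED AT
A STOPPING TIME consume (e.g. "after first hitting a small disc at time `τ`, the planar path leaves a
larger disc before touching a smaller one with probability at most a ratio of logarithms"):

* `isStoppingTime_piecewise_of_le` — for stopping times `τ ≤ η` and `A ∈ 𝓕_τ`, the random time
  equal to `τ` on `A` and to `η` off `A` is a stopping time (Mathlib's
  `IsStoppingTime.piecewise_of_le` wants `A ∈ 𝓕_i` for a deterministic lower bound `i`);
* `IsBrownianVec.setIntegral_stoppedProcess_dynkin_sub` — **`∫_A (M^f_{t∧σ} − M^f_{t∧τ}) dP = 0`**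
  for `f ∈ C²_c`, stopping times `τ ≤ σ` of the natural filtration and `A ∈ 𝓕_τ` (optional stopping
  at the piecewise stopping time and at `σ`, subtracted);
* `IsBrownianVec.setIntegral_stopped_sub_of_confined` — the same identity for a function `V` that
  is only `C²` with CONSTANT Laplacian `ΔV = g` on an open set `U`, along paths which stay in a
  compact `K ⊆ U` between the two stopped times:
  `∫_A (V(X_{t∧σ}) − V(X_{t∧τ}) − (g/2)((t∧σ) − (t∧τ))) dP = 0`, `X = x₀ + W` (smooth cutoff
  `exists_contDiff_cutoff`, as in `integral_stoppedProcess_eq_of_harmonic`). With `g = 0` this is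
  the harmonic case (e.g. `V = log |· − c|` in the plane), with `V = |· − c|²`, `g = 2d`, it controls
  the time spent in a ball.

Everything is proved for the raw natural filtration; no named fact is introduced.

## References

* J.-F. Le Gall, *Brownian Motion, Martingales, and Stochastic Calculus*, GTM 274 (2016), Ch. 3
  Cor. 3.23 (optional stopping `E[X_τ; A] = E[X_σ; A]`, `A ∈ 𝓕_τ`) and Ch. 7 §7.2. [Legall2016]
* D. Revuz, M. Yor, *Continuous Martingales and Brownian Motion* (1999), Ch. II §3. [folklore]
-/

noncomputable section

open MeasureTheory ProbabilityTheory Filter Topology Set Metric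
open scoped NNReal ENNReal BigOperators

namespace Literature.Probability.Process

/-! ### Piecewise stopping times -/

/-- **Gluing two stopping times along an event of the earlier one.** If `τ ≤ η` are stopping times
and `s ∈ 𝓕_τ`, then `s.piecewise τ η` (`= τ` on `s`, `= η` off `s`) is a stopping time:
`{· ≤ n} = (s ∩ {τ ≤ n}) ∪ (sᶜ ∩ {η ≤ n})` with `sᶜ ∈ 𝓕_τ ≤ 𝓕_η`.
[cite: Legall2016, Ch. 3 Cor. 3.23] -/
theorem isStoppingTime_piecewise_of_le {Ω ι : Type*} [Preorder ι] {m : MeasurableSpace Ω}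
    {𝒢 : Filtration ι m} {τ η : Ω → WithTop ι} {s : Set Ω} [DecidablePred (· ∈ s)]
    (hτ : IsStoppingTime 𝒢 τ) (hη : IsStoppingTime 𝒢 η) (hle : τ ≤ η)
    (hs : MeasurableSet[hτ.measurableSpace] s) : IsStoppingTime 𝒢 (s.piecewise τ η) := by
  intro n
  have hset : {ω | s.piecewise τ η ω ≤ n} = s ∩ {ω | τ ω ≤ n} ∪ sᶜ ∩ {ω | η ω ≤ n} := by
    ext1 ω
    simp only [Set.piecewise, Set.mem_setOf_eq]
    by_cases hx : ω ∈ s <;> simp [hx]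
  rw [hset]
  have h1 : MeasurableSet[𝒢 n] (s ∩ {ω | τ ω ≤ n}) := hs.2 n
  have hsc : MeasurableSet[hη.measurableSpace] sᶜ :=
    IsStoppingTime.measurableSpace_mono hτ hη hle _ hs.compl
  have h2 : MeasurableSet[𝒢 n] (sᶜ ∩ {ω | η ω ≤ n}) := hsc.2 n
  exact h1.union h2

/-- Monotonicity of the stopped clock in the stopping time: `t ∧ a ≤ t ∧ b` for `a ≤ b` (read in
`ℝ≥0` through `untopA`). [folklore] -/
theorem untopA_min_coe_le_of_le (t : ℝ≥0) {a b : WithTop ℝ≥0} (h : a ≤ b) :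
    (min (t : WithTop ℝ≥0) a).untopA ≤ (min (t : WithTop ℝ≥0) b).untopA := by
  induction b with
  | top => rw [untopA_min_coe_top]; exact untopA_min_coe_le t a
  | coe B =>
    induction a with
    | top => exact absurd h (not_le.2 (WithTop.coe_lt_top B))
    | coe A =>
      rw [untopA_min_coe_coe, untopA_min_coe_coe]
      exact min_le_min le_rfl (WithTop.coe_le_coe.1 h)

namespace IsBrownianVec

variable {Ω : Type*} {mΩ : MeasurableSpace Ω} {P : Measure Ω} {d : ℕ}
variable {W : ℝ≥0 → Ω → (Fin d → ℝ)} {f : (Fin d → ℝ) → ℝ} {x₀ : Fin d → ℝ}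

/-! ### Dynkin's martingale between two stopping times -/

/-- **Optional stopping between two stopping times for Dynkin's martingale.** For `f ∈ C²_c`,
stopping times `τ ≤ σ` of the natural filtration of `W`, an event `A ∈ 𝓕_τ` and a time `t`,
`∫_A (M^f_{t∧σ} − M^f_{t∧τ}) dP = 0`. (Apply `integral_stoppedProcess_dynkin` to the stopping time
equal to `τ` on `A` and `σ` off `A`, and to `σ`; subtract.) [cite: Legall2016, Ch. 3 Cor. 3.23] -/
theorem setIntegral_stoppedProcess_dynkin_sub [IsProbabilityMeasure P] (hW : IsBrownianVec W P)
    (hf : ContDiff ℝ 2 f) (hc : HasCompactSupport f) (x₀ : Fin d → ℝ) {τ σ : Ω → WithTop ℝ≥0}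
    (hτ : IsStoppingTime hW.natFiltration τ) (hσ : IsStoppingTime hW.natFiltration σ) (hle : τ ≤ σ)
    {A : Set Ω} (hA : MeasurableSet[hτ.measurableSpace] A) (t : ℝ≥0) :
    ∫ ω in A, (stoppedProcess (dynkin f x₀ W) σ t ω - stoppedProcess (dynkin f x₀ W) τ t ω) ∂P = 0 := by
  classical
  have hAm : MeasurableSet A := hτ.measurableSpace_le _ hA
  have hπst : IsStoppingTime hW.natFiltration (A.piecewise τ σ) :=
    isStoppingTime_piecewise_of_le hτ hσ hle hA
  obtain ⟨hiτ, -⟩ := hW.integral_stoppedProcess_dynkin hf hc x₀ hτ t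
  obtain ⟨hiσ, h0σ⟩ := hW.integral_stoppedProcess_dynkin hf hc x₀ hσ t
  obtain ⟨-, h0π⟩ := hW.integral_stoppedProcess_dynkin hf hc x₀ hπst t
  -- the stopped process at the glued time, pointwise
  have hpt : ∀ ω, stoppedProcess (dynkin f x₀ W) (A.piecewise τ σ) t ω =
      A.indicator (stoppedProcess (dynkin f x₀ W) τ t) ω +
        Aᶜ.indicator (stoppedProcess (dynkin f x₀ W) σ t) ω := by
    intro ω
    by_cases hω : ω ∈ A
    · simp [stoppedProcess, Set.piecewise, hω]
    · simp [stoppedProcess, Set.piecewise, hω]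
  have e1 : ∫ ω, stoppedProcess (dynkin f x₀ W) (A.piecewise τ σ) t ω ∂P =
      ∫ ω in A, stoppedProcess (dynkin f x₀ W) τ t ω ∂P +
        ∫ ω in Aᶜ, stoppedProcess (dynkin f x₀ W) σ t ω ∂P := by
    rw [integral_congr_ae (ae_of_all _ hpt), integral_add (hiτ.indicator hAm) (hiσ.indicator hAm.compl),
      integral_indicator hAm, integral_indicator hAm.compl]
  have e2 : ∫ ω, stoppedProcess (dynkin f x₀ W) σ t ω ∂P =
      ∫ ω in A, stoppedProcess (dynkin f x₀ W) σ t ω ∂P +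
        ∫ ω in Aᶜ, stoppedProcess (dynkin f x₀ W) σ t ω ∂P :=
    (integral_add_compl hAm hiσ).symm
  rw [integral_sub hiσ.integrableOn hiτ.integrableOn]
  linarith

/-- **Dynkin's identity between two stopping times for a locally defined function, along confined
paths.** Let `U ⊆ ℝᵈ` be open, `V` of class `C²` on `U` with constant Laplacian `ΔV = g` on `U`,
`K ⊆ U` compact; `τ ≤ σ` stopping times of the natural filtration, `A ∈ 𝓕_τ`, `t ≥ 0`. If along
every path of `A` the process `X = x₀ + W` stays in `K` between the stopped times `t ∧ τ` and
`t ∧ σ`, then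

  `∫_A ( V(X_{t∧σ}) − V(X_{t∧τ}) − (g/2)·((t∧σ) − (t∧τ)) ) dP = 0`.

(and the integrand is integrable on `A`). (Multiply `V` by a smooth cutoff equal to `1` near
`K` to get a `C²_c` function with the same values and Laplacian near `K`, and apply
`setIntegral_stoppedProcess_dynkin_sub`.)
[cite: Legall2016, Ch. 7 §7.2, proof of Prop. 7.3] -/
theorem setIntegral_stopped_sub_of_confined [IsProbabilityMeasure P] (hW : IsBrownianVec W P)
    {U : Set (Fin d → ℝ)} (hU : IsOpen U) {V : (Fin d → ℝ) → ℝ} (hV : ContDiffOn ℝ 2 V U)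
    {g : ℝ} (hΔ : ∀ y ∈ U, lap V y = g) {K : Set (Fin d → ℝ)} (hK : IsCompact K) (hKU : K ⊆ U)
    {x₀ : Fin d → ℝ} {τ σ : Ω → WithTop ℝ≥0} (hτ : IsStoppingTime hW.natFiltration τ)
    (hσ : IsStoppingTime hW.natFiltration σ) (hle : τ ≤ σ) {A : Set Ω}
    (hA : MeasurableSet[hτ.measurableSpace] A) (t : ℝ≥0)
    (hconf : ∀ ω ∈ A, ∀ r : ℝ≥0, (min (t : WithTop ℝ≥0) (τ ω)).untopA ≤ r →
      r ≤ (min (t : WithTop ℝ≥0) (σ ω)).untopA → x₀ + W r ω ∈ K) :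
    IntegrableOn (fun ω ↦ V (x₀ + W (min (t : WithTop ℝ≥0) (σ ω)).untopA ω) -
        V (x₀ + W (min (t : WithTop ℝ≥0) (τ ω)).untopA ω) -
        g / 2 * (((min (t : WithTop ℝ≥0) (σ ω)).untopA : ℝ) - (min (t : WithTop ℝ≥0) (τ ω)).untopA)) A P ∧
    ∫ ω in A, (V (x₀ + W (min (t : WithTop ℝ≥0) (σ ω)).untopA ω) -
        V (x₀ + W (min (t : WithTop ℝ≥0) (τ ω)).untopA ω) -
        g / 2 * (((min (t : WithTop ℝ≥0) (σ ω)).untopA : ℝ) - (min (t : WithTop ℝ≥0) (τ ω)).untopA)) ∂P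
      = 0 := by
  obtain ⟨χ, hχ, hχc, hχU, O, hO, hKO, hOU, hχ1⟩ := exists_contDiff_cutoff hK hU hKU
  -- the globally `C²_c` function `F = χ V`
  set F : (Fin d → ℝ) → ℝ := fun y ↦ χ y * V y with hFdef
  have hFV : ∀ y ∈ O, F =ᶠ[𝓝 y] V := fun y hy ↦ by
    filter_upwards [hO.mem_nhds hy] with z hz
    simp [hFdef, hχ1 z hz]
  have hF2 : ContDiff ℝ 2 F := by
    rw [contDiff_iff_contDiffAt]
    intro y
    by_cases hy : y ∈ U
    · exact (hχ.contDiffAt).mul (hV.contDiffAt (hU.mem_nhds hy))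
    · have hy' : y ∉ tsupport χ := fun h ↦ hy (hχU h)
      have h0 : F =ᶠ[𝓝 y] fun _ ↦ 0 := by
        filter_upwards [(isClosed_tsupport χ).isOpen_compl.mem_nhds hy'] with z hz
        simp [hFdef, image_eq_zero_of_notMem_tsupport hz]
      exact (contDiffAt_const (c := (0 : ℝ))).congr_of_eventuallyEq h0
  have hFc : HasCompactSupport F := hχc.mul_right
  have hlapF : ∀ y ∈ O, lap F y = g := fun y hy ↦ by
    rw [lap_congr_of_eventuallyEq (hFV y hy)]
    exact hΔ y (hOU hy)
  have hFK : ∀ y ∈ K, F y = V y := fun y hy ↦ by simp [hFdef, hχ1 y (hKO hy)]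
  -- optional stopping between `τ` and `σ` for Dynkin's martingale of `F`
  have h0 := hW.setIntegral_stoppedProcess_dynkin_sub hF2 hFc x₀ hτ hσ hle hA t
  have hAm : MeasurableSet A := hτ.measurableSpace_le _ hA
  -- along the path of `ω ∈ A`, the Dynkin increment is the claimed expression
  have hpt : ∀ ω ∈ A, stoppedProcess (dynkin F x₀ W) σ t ω - stoppedProcess (dynkin F x₀ W) τ t ω =
      V (x₀ + W (min (t : WithTop ℝ≥0) (σ ω)).untopA ω) -
        V (x₀ + W (min (t : WithTop ℝ≥0) (τ ω)).untopA ω) -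
        g / 2 * (((min (t : WithTop ℝ≥0) (σ ω)).untopA : ℝ) - (min (t : WithTop ℝ≥0) (τ ω)).untopA) := by
    intro ω hω
    simp only [stoppedProcess]
    set s₁ : ℝ≥0 := (min (t : WithTop ℝ≥0) (τ ω)).untopA with hs₁
    set s₂ : ℝ≥0 := (min (t : WithTop ℝ≥0) (σ ω)).untopA with hs₂
    have h12 : s₁ ≤ s₂ := untopA_min_coe_le_of_le t (hle ω)
    have hmemK : ∀ r : ℝ≥0, s₁ ≤ r → r ≤ s₂ → x₀ + W r ω ∈ K := fun r h1 h2 ↦ hconf ω hω r h1 h2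
    rw [hW.dynkin_sub hF2, hFK _ (hmemK s₂ h12 le_rfl), hFK _ (hmemK s₁ le_rfl h12)]
    have hI : ∫ r in (s₁ : ℝ)..s₂, lap F (x₀ + W r.toNNReal ω) = g * ((s₂ : ℝ) - s₁) := by
      rw [intervalIntegral.integral_congr (g := fun _ ↦ g) fun r hr ↦ ?_, intervalIntegral.integral_const,
        smul_eq_mul, mul_comm]
      rw [uIcc_of_le (NNReal.coe_le_coe.2 h12)] at hr
      refine hlapF _ (hKO (hmemK _ ?_ ?_))
      · exact NNReal.le_toNNReal_of_coe_le hr.1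
      · exact Real.toNNReal_le_iff_le_coe.2 hr.2
    rw [hI]
    ring
  have hint : Integrable (fun ω ↦ stoppedProcess (dynkin F x₀ W) σ t ω - stoppedProcess (dynkin F x₀ W) τ t ω) P :=
    (hW.integral_stoppedProcess_dynkin hF2 hFc x₀ hσ t).1.sub
      (hW.integral_stoppedProcess_dynkin hF2 hFc x₀ hτ t).1
  refine ⟨hint.integrableOn.congr_fun hpt hAm, ?_⟩
  rw [← h0]
  exact setIntegral_congr_fun hAm fun ω hω ↦ (hpt ω hω).symm

/-! ### Measurability of the process read at a stopped time -/

/-- **The process `X = x₀ + W` read at the stopped time `t ∧ τ` is measurable** (a continuous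
adapted process is progressively measurable: Mathlib
`StronglyAdapted.isStronglyProgressive_of_continuous`,
`IsStronglyProgressive.stronglyMeasurable_stoppedProcess`). [folklore] -/
theorem measurable_stoppedProcess_path (hW : IsBrownianVec W P) (x₀ : Fin d → ℝ)
    {τ : Ω → WithTop ℝ≥0} (hτ : IsStoppingTime hW.natFiltration τ) (t : ℝ≥0) :
    Measurable (stoppedProcess (fun r ω ↦ x₀ + W r ω) τ t) := by
  have hSA : StronglyAdapted hW.natFiltration fun r ω ↦ x₀ + W r ω := fun r ↦
    (stronglyMeasurable_const.add (hW.stronglyAdapted r))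
  exact ((hSA.isStronglyProgressive_of_continuous fun ω ↦
    continuous_const.add (hW.continuous_path ω)).stronglyMeasurable_stoppedProcess hτ t).measurable

/-- The stopped clock `t ∧ τ` (read in `ℝ≥0`) is measurable. [folklore] -/
theorem measurable_untopA_min (hW : IsBrownianVec W P) {τ : Ω → WithTop ℝ≥0}
    (hτ : IsStoppingTime hW.natFiltration τ) (t : ℝ≥0) :
    Measurable fun ω ↦ (min (t : WithTop ℝ≥0) (τ ω)).untopA := by
  have hm : Measurable τ := hτ.measurable'
  have h1 : Measurable fun ω ↦ min (t : WithTop ℝ≥0) (τ ω) := measurable_const.min hm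
  exact WithTop.measurable_untopA.comp h1

end IsBrownianVec

end Literature.Probability.Process

end
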